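import Literature.NumberTheory.DiophantineGeometry.AbcWave0
import Summits.ABC.ABC.Theorems.IneffectiveSubspaceDepthCountedABCStubQuarticThueWindow

/-!
# Stub `stub_thueMahlerOfCellOneLittleO` of line `Sketch` — crux `DepthCountedABC` (stmt-ABC-14938)

WHAT.  The converse, on the depth cell `ω₅(abc) ≤ 1` (at most one prime to exponent `≥ 5`), of the
cell-1 little-o certificate `stub_cellOneLittleO` (`c = o(rad(abc)⁴)` on the cell, a theorem by Ridout):
IF for every `κ > 0` only boundedly many abc triples of the cell have `c ≥ κ·rad(abc)⁴`, THEN for every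
single Thue–Mahler datum `(a, u, v, p)` (`p` prime, `a, u, v ≥ 1`) the value of `c` is bounded over the
solutions of BOTH binomial quartic Thue–Mahler shapes whose triple lies in the cell:
`a + p^k·u = v·Z⁴` (triple `(a, p^k u, v Z⁴)`, bound on `c = v·Z⁴`) and `a + u·Y⁴ = p^w·v`
(triple `(a, u Y⁴, p^w v)`, bound on `c = p^w·v`) — Thue–Mahler finiteness, fibre by fibre, on the cell.

MECHANISM (elementary).  With `M := a·p·u·v ≥ 1`: for the first shape
`rad(abc) ≤ rad a · rad(p^k u) · rad(v Z⁴) ≤ a·(p u)·(v Z) = M·Z` and `Z⁴ ≤ v Z⁴ = c`, so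
`rad⁴ ≤ M⁴·c`; for the second shape `rad(abc) ≤ a·(u Y)·(p v) = M·Y` and `Y⁴ ≤ u Y⁴ ≤ c`, so again
`rad⁴ ≤ M⁴·c`.  At `κ := M⁻⁴` the hypothesis gives `c₀` with `c < κ·rad⁴ ≤ c` whenever `c ≥ c₀` — so
`c < c₀`, and `B := c₀` bounds `c` in both shapes.

Sources: skeleton `Cruxes/DepthCountedABC/Lines/Sketch.lean` (lead c23, wave 2), stub
`stub_thueMahlerOfCellOneLittleO`; the radical bookkeeping is adapted from the accepted siblings
`…StubThueOfCellZeroLittleO` (the cell-0 analogue) and `…StubThueMahlerWindow`, and reuses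
`radical_mul_pow_four_le` of `…StubQuarticThueWindow`.
Ingredients: `Literature.NumberTheory.DiophantineGeometry.rad_def`, Mathlib's radical API
(`UniqueFactorizationMonoid.radical_mul_dvd`, `UniqueFactorizationMonoid.radical_pow`,
`UniqueFactorizationMonoid.radical_one`, `Nat.radical_le_self_iff`).  No unproved facts.  Deliberately
NOT here: the forward direction (`stub_cellOneLittleO`, landed separately) and anything uniform in
`(a, u, v, p)`.
-/

-- `Summit.<Summit>.<Problem>` is the mandated summit-side namespace (CONVENTIONS §2); for the
-- single-conjunct summit `ABC` the two coincide, so the duplicate `ABC.ABC` is deliberate.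
set_option linter.dupNamespace false

namespace Summit.ABC.ABC.Theorems.DepthCountedABC

open UniqueFactorizationMonoid (radical)
open Literature.NumberTheory.DiophantineGeometry (IsABCTriple rad rad_def)

/-- In an equation `a + b = c`, coprimality of `b` and `c` gives coprimality of `a` and `b`. [folklore] -/
theorem thueMahlerOfCellOneLittleO_coprime_of_sum {a b c : ℕ} (hsum : a + b = c)
    (hcop : Nat.Coprime b c) : Nat.Coprime a b := by
  -- adapted from `…StubThueMahlerWindow` (`coprime_of_sum`)
  have h1 : Nat.Coprime b (a + b) := by rw [hsum]; exact hcop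
  exact (Nat.coprime_add_self_right.mp h1).symm

/-- Sub-multiplicativity of the radical of a triple: `rad(abc) ≤ A·B·D` once `rad a ≤ A`, `rad b ≤ B`,
`rad c ≤ D`. [folklore] -/
theorem thueMahlerOfCellOneLittleO_rad_le_mul₃ {a b c A B D : ℕ} (ha : radical a ≤ A)
    (hb : radical b ≤ B) (hc : radical c ≤ D) : rad a b c ≤ A * B * D := by
  -- adapted from `…StubThueMahlerWindow` (`rad_le_mul3`)
  have h2 : radical (a * b * c) ≤ radical (a * b) * radical c :=
    Nat.le_of_dvd (by positivity) UniqueFactorizationMonoid.radical_mul_dvd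
  have h3 : radical (a * b) ≤ radical a * radical b :=
    Nat.le_of_dvd (by positivity) UniqueFactorizationMonoid.radical_mul_dvd
  calc rad a b c = radical (a * b * c) := rad_def a b c
    _ ≤ radical a * radical b * radical c := h2.trans (Nat.mul_le_mul_right _ h3)
    _ ≤ A * B * D := Nat.mul_le_mul (Nat.mul_le_mul ha hb) hc

/-- `rad(p^k · u) ≤ p · u` for a prime `p` and `u ≥ 1`. [folklore] -/
theorem thueMahlerOfCellOneLittleO_radical_prime_pow_mul_le {p k u : ℕ} (hp : p.Prime)
    (hu : 0 < u) : radical (p ^ k * u) ≤ p * u := by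
  -- adapted from `…StubThueMahlerWindow` (`radical_prime_pow_mul_le`)
  have h1 : radical (p ^ k * u) ∣ radical (p ^ k) * radical u :=
    UniqueFactorizationMonoid.radical_mul_dvd
  have h2 : radical (p ^ k) ≤ p := by
    rcases Nat.eq_zero_or_pos k with rfl | hk
    · rw [pow_zero, UniqueFactorizationMonoid.radical_one]; exact hp.one_lt.le
    · rw [UniqueFactorizationMonoid.radical_pow p hk.ne']
      exact Nat.radical_le_self_iff.mpr hp.ne_zero
  calc radical (p ^ k * u) ≤ radical (p ^ k) * radical u := Nat.le_of_dvd (by positivity) h1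
    _ ≤ p * u := Nat.mul_le_mul h2 (Nat.radical_le_self_iff.mpr hu.ne')

/-- The contradiction common to both shapes: if the cell-1 little-o statement holds at `κ = M⁻⁴` with
threshold `c₀`, then every abc triple `(a, b, c)` of the cell with `rad(abc)⁴ ≤ M⁴·c` has `c < c₀`
(otherwise `c < M⁻⁴·rad⁴ ≤ c`). [folklore] -/
theorem thueMahlerOfCellOneLittleO_lt_of_rad_pow_le {M c₀ : ℕ} (hM : 0 < M)
    (hc₀ : ∀ a b c : ℕ, IsABCTriple a b c →
      ((a * b * c).primeFactors.filter (fun p => 5 ≤ (a * b * c).factorization p)).card ≤ 1 →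
      c₀ ≤ c → (c : ℝ) < ((M : ℝ) ^ 4)⁻¹ * ((rad a b c : ℕ) : ℝ) ^ 4)
    {a b c : ℕ} (habc : IsABCTriple a b c)
    (hcell : ((a * b * c).primeFactors.filter (fun p => 5 ≤ (a * b * c).factorization p)).card ≤ 1)
    (hrad : rad a b c ^ 4 ≤ M ^ 4 * c) : c < c₀ := by
  by_contra hge
  have hlt := hc₀ a b c habc hcell (not_lt.mp hge)
  have hMpos : (0 : ℝ) < (M : ℝ) := by exact_mod_cast hM
  have hR : ((rad a b c : ℕ) : ℝ) ^ 4 ≤ (M : ℝ) ^ 4 * (c : ℝ) := by exact_mod_cast hrad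
  have hcontra : (c : ℝ) < (c : ℝ) :=
    calc (c : ℝ) < ((M : ℝ) ^ 4)⁻¹ * ((rad a b c : ℕ) : ℝ) ^ 4 := hlt
      _ ≤ ((M : ℝ) ^ 4)⁻¹ * ((M : ℝ) ^ 4 * (c : ℝ)) := mul_le_mul_of_nonneg_left hR (by positivity)
      _ = (c : ℝ) := by rw [← mul_assoc, inv_mul_cancel₀ (by positivity), one_mul]
  exact lt_irrefl _ hcontra

/-- **Stub `stub_thueMahlerOfCellOneLittleO` of line `Sketch`, crux `DepthCountedABC` (stmt-ABC-14938):**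
the cell-1 little-o statement (`∀ κ > 0 ∃ c₀`, every abc triple with at most one prime to exponent `≥ 5`
and `c ≥ c₀` has `c < κ·rad⁴`) implies, for every Thue–Mahler datum `(a, u, v, p)` (`p` prime,
`a, u, v ≥ 1`), a bound on `c = v·Z⁴` over the solutions of `a + p^k·u = v·Z⁴` with
`gcd(p^k u, v Z⁴) = 1` whose triple lies in the cell, and a bound on `c = p^w·v` over the solutions of
`a + u·Y⁴ = p^w·v` with `gcd(u Y⁴, p^w v) = 1` whose triple lies in the cell — Thue–Mahler finiteness
for these binomial quartic equations, fibrewise, on the cell. [folklore] -/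
theorem stub_thueMahlerOfCellOneLittleO :
    (∀ κ : ℝ, 0 < κ → ∃ c₀ : ℕ, ∀ a b c : ℕ,
      Literature.NumberTheory.DiophantineGeometry.IsABCTriple a b c →
      ((a * b * c).primeFactors.filter (fun p => 5 ≤ (a * b * c).factorization p)).card ≤ 1 →
      c₀ ≤ c → (c : ℝ) < κ * ((Literature.NumberTheory.DiophantineGeometry.rad a b c : ℕ) : ℝ) ^ 4) →
    ∀ a u v p : ℕ, p.Prime → 0 < a → 0 < u → 0 < v →
      (∃ B : ℕ, ∀ k Z : ℕ, 0 < Z → a + p ^ k * u = v * Z ^ 4 → Nat.Coprime (p ^ k * u) (v * Z ^ 4) →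
          ((a * (p ^ k * u) * (v * Z ^ 4)).primeFactors.filter
            (fun q => 5 ≤ (a * (p ^ k * u) * (v * Z ^ 4)).factorization q)).card ≤ 1 → v * Z ^ 4 ≤ B) ∧
      (∃ B : ℕ, ∀ w Y : ℕ, 0 < Y → a + u * Y ^ 4 = p ^ w * v → Nat.Coprime (u * Y ^ 4) (p ^ w * v) →
          ((a * (u * Y ^ 4) * (p ^ w * v)).primeFactors.filter
            (fun q => 5 ≤ (a * (u * Y ^ 4) * (p ^ w * v)).factorization q)).card ≤ 1 → p ^ w * v ≤ B) := by
  intro h a u v p hp ha hu hv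
  have hp0 : 0 < p := hp.pos
  -- the constant `M = a·p·u·v` of the datum and the threshold `c₀` at `κ = M⁻⁴`
  have hM : 0 < a * p * u * v := by positivity
  have hMpos : (0 : ℝ) < ((a * p * u * v : ℕ) : ℝ) := by exact_mod_cast hM
  obtain ⟨c₀, hc₀⟩ := h (((a * p * u * v : ℕ) : ℝ) ^ 4)⁻¹ (by positivity)
  refine ⟨⟨c₀, ?_⟩, ⟨c₀, ?_⟩⟩
  · -- first shape: the abc triple `(a, p^k u, v Z⁴)`, `rad ≤ M·Z`, `Z⁴ ≤ c`
    intro k Z hZ hsum hcop hcard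
    have hb : 0 < p ^ k * u := by positivity
    have habc : IsABCTriple a (p ^ k * u) (v * Z ^ 4) :=
      ⟨ha, hb, hsum, thueMahlerOfCellOneLittleO_coprime_of_sum hsum hcop⟩
    have hR : rad a (p ^ k * u) (v * Z ^ 4) ≤ a * (p * u) * (v * Z) :=
      thueMahlerOfCellOneLittleO_rad_le_mul₃ (Nat.radical_le_self_iff.mpr ha.ne')
        (thueMahlerOfCellOneLittleO_radical_prime_pow_mul_le hp hu)
        (radical_mul_pow_four_le hv hZ)
    have hrad : rad a (p ^ k * u) (v * Z ^ 4) ^ 4 ≤ (a * p * u * v) ^ 4 * (v * Z ^ 4) :=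
      calc rad a (p ^ k * u) (v * Z ^ 4) ^ 4 ≤ (a * (p * u) * (v * Z)) ^ 4 := Nat.pow_le_pow_left hR 4
        _ = (a * p * u * v) ^ 4 * Z ^ 4 := by ring
        _ ≤ (a * p * u * v) ^ 4 * (v * Z ^ 4) :=
            Nat.mul_le_mul_left _ (Nat.le_mul_of_pos_left _ hv)
    exact (thueMahlerOfCellOneLittleO_lt_of_rad_pow_le hM hc₀ habc hcard hrad).le
  · -- second shape: the abc triple `(a, u Y⁴, p^w v)`, `rad ≤ M·Y`, `Y⁴ ≤ u Y⁴ ≤ c`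
    intro w Y hY hsum hcop hcard
    have hb : 0 < u * Y ^ 4 := by positivity
    have habc : IsABCTriple a (u * Y ^ 4) (p ^ w * v) :=
      ⟨ha, hb, hsum, thueMahlerOfCellOneLittleO_coprime_of_sum hsum hcop⟩
    have hR : rad a (u * Y ^ 4) (p ^ w * v) ≤ a * (u * Y) * (p * v) :=
      thueMahlerOfCellOneLittleO_rad_le_mul₃ (Nat.radical_le_self_iff.mpr ha.ne')
        (radical_mul_pow_four_le hu hY)
        (thueMahlerOfCellOneLittleO_radical_prime_pow_mul_le hp hv)
    have hY4 : Y ^ 4 ≤ p ^ w * v :=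
      calc Y ^ 4 ≤ u * Y ^ 4 := Nat.le_mul_of_pos_left _ hu
        _ ≤ a + u * Y ^ 4 := Nat.le_add_left _ _
        _ = p ^ w * v := hsum
    have hrad : rad a (u * Y ^ 4) (p ^ w * v) ^ 4 ≤ (a * p * u * v) ^ 4 * (p ^ w * v) :=
      calc rad a (u * Y ^ 4) (p ^ w * v) ^ 4 ≤ (a * (u * Y) * (p * v)) ^ 4 := Nat.pow_le_pow_left hR 4
        _ = (a * p * u * v) ^ 4 * Y ^ 4 := by ring
        _ ≤ (a * p * u * v) ^ 4 * (p ^ w * v) := Nat.mul_le_mul_left _ hY4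
    exact (thueMahlerOfCellOneLittleO_lt_of_rad_pow_le hM hc₀ habc hcard hrad).le

end Summit.ABC.ABC.Theorems.DepthCountedABC
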